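import Summits.PneNP.PneNP.Theorems.OneSliceConstantBandReadVars
import Summits.PneNP.PneNP.Theorems.OneSliceConstantBandSliceNegCorr
import Summits.PneNP.PneNP.Theorems.OneSliceConstantBandExponentOneAux
import Summits.PneNP.PneNP.Theorems.OneSliceSliceTargetCliqueDensityLower
import Summits.PneNP.PneNP.Theorems.OneSliceBandImpliesThreshold
import Literature.Computability.Complexity.NegationElimination

/-!
# Route OneSlice, crux `ConstantBand` (stmt-PneNP-2834): the unconditional low-exponent rungs of the crux schedule

Lead seat c7 (2026-08-17), line `flat-prior-relative-minterms`, `--supports stmt-PneNP-2834`. The crux in schedule form is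
`∀ c, ∃ k ≥ 3, ∃ w, ∃ δ > 0, BandLB c k w δ` (`constantBand_iff`, `Theorems/ConstantBand/Negative/LoadBearing.lean`). This
file PROVES the rungs `c ≤ 1` — for EVERY `k ≥ 3` and every width `w` — and, more precisely, a quadratic gate lower
bound for accuracy on ONE central slice:

* `fprm_sliceErr_ge_of_junta` — for `k ≥ 3`, on a slice `j` whose clique density lies in `[5/(6k!), 1/3]` and on which
  the `k`-cliques touching a set `V` of edges are rare (`≤ #slice/(12k!)`), every MONOTONE `f` reading only the edges in
  `V` disagrees with `CLIQUE_k` on at least `3/(8k!) · #slice` graphs. Proof: split `CLIQUE_k = CL₀ ∨ CL₁` (cliques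
  avoiding / touching `V`); `CL₀` is monotone and reads only edges outside `V`, so `f` and `CL₀` are NEGATIVELY
  correlated on the slice (`fprm_slice_negCorr`, `Theorems/OneSliceConstantBandSliceNegCorr.lean`); hence either `f`
  rejects half of `CL₀` or accepts a third of the non-clique graphs.
* `fprm_sliceErr_ge_of_small` — eventually in `n`, for every central `j`, every `{∧₂,∨₂}`-circuit `C` with
  `(2|C|+1)·4k(k-1)k! ≤ n(n-1)` errs on `≥ 3/(8k!) · #slice_j` graphs of the slice (light cone `≤ 2|C|+1`,
  `fprm_lightCone_junta`, `Theorems/OneSliceConstantBandReadVars.lean`; cliques touching it are rare,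
  `fprm_card_slice_cliqueTouch_le`, `Theorems/OneSliceConstantBandExponentOneAux.lean`; clique density window from
  `stub_cliqueDensityLower` and `ts_eventually_window`): **Ω_k(n²) gates for `1/(4k!)`-accuracy on one central slice**.
* `fprm_bandLB_one` — `BandLB 1 k w (1/(4·k!))` for every `k ≥ 3` and every `w`; `fprm_constantBandSchedule_le_one` —
  the crux schedule at every exponent `c ≤ 1`; `fprm_lowerBoundAt_one` — the same rung of crux #2 (`SingleThreshold`'s
  schedule `LowerBoundAt 1 k (1/(8k!))`, through the exponent-wise transfer `lowerBoundAt_of_bandLB` of stmt-PneNP-2839).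

Together with the disprover's `le_of_bandLB` (`c ≤ k+2`) and `delta_le_of_bandLB` (`δ ≤ (2w+1)/k!`) this boxes any kill
of the crux into `2 ≤ c ≤ k+2`; the first OPEN rung is `c = 2` (`> n² = 2·C(n,2) + n` gates, a `(2+ε)N` lower bound for
slice-approximate monotone `CLIQUE`). [folklore]
-/

set_option linter.dupNamespace false

noncomputable section

namespace Summit.PneNP.PneNP.Cruxes.ConstantBand.FlatPriorRelativeMinterms

open Literature.Computability.Complexity Finset Filter Classical
open Summit.PneNP.PneNP.Cruxes.SliceACZero.RussoWindowLadder (wt)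
open Summit.PneNP.PneNP.Cruxes.SliceTarget.Ideator3Line (stub_cliqueDensityLower)

variable {n : ℕ}

/-! ## One slice: juntas err on a constant fraction -/

/-- **Monotone juntas err on a constant fraction of a central slice.** For `k ≥ 3`, a slice `j ≤ C(n,2)` with clique
density in `[5/(6k!), 1/3]`, and a set `V` of edges whose touching `k`-cliques are rare on the slice
(`≤ #slice/(12k!)`): every monotone `f` that reads only the edges in `V` disagrees with `CLIQUE_k` on at least
`3/(8k!) · #slice_j` graphs of the slice. [folklore] -/
theorem fprm_sliceErr_ge_of_junta {k j : ℕ} (hk : 3 ≤ k) (V : Finset (Edge n)) (f : (Edge n → Bool) → Bool)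
    (hf : Monotone f) (hfV : ∀ x y : Edge n → Bool, (∀ e ∈ V, x e = y e) → f x = f y) (hj : j ≤ n.choose 2)
    (hlow : 5 / (6 * (k.factorial : ℝ)) * #(slice n j) ≤ #((slice n j).filter fun x => cliqueFn n k x = true))
    (hup : (#((slice n j).filter fun x => cliqueFn n k x = true) : ℝ) ≤ 1 / 3 * #(slice n j))
    (htouch : (#((slice n j).filter fun x => ∃ A ∈ powersetCard k (univ : Finset (Fin n)),
        (∃ e ∈ V, cliqueVec A e = true) ∧ ∀ e, cliqueVec A e = true → x e = true) : ℝ) ≤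
      1 / (12 * (k.factorial : ℝ)) * #(slice n j)) :
    3 / (8 * (k.factorial : ℝ)) * #(slice n j) ≤ #((slice n j).filter fun x => f x ≠ cliqueFn n k x) := by
  -- `CL₀`: a `k`-clique avoiding `V`
  set CL0 : (Edge n → Bool) → Bool := fun x => decide (∃ A ∈ powersetCard k (univ : Finset (Fin n)),
    (∀ e, cliqueVec A e = true → e ∉ V) ∧ ∀ e, cliqueVec A e = true → x e = true) with hCL0
  have hCL0m : Monotone CL0 := by
    intro x y hxy hx
    simp only [hCL0, decide_eq_true_eq] at hx ⊢
    obtain ⟨A, hA, hAV, hAx⟩ := hx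
    refine ⟨A, hA, hAV, fun e he => ?_⟩
    have := hxy e
    rw [hAx e he] at this
    exact top_le_iff.1 this
  have hCL0V : ∀ x y : Edge n → Bool, (∀ e ∉ V, x e = y e) → CL0 x = CL0 y := by
    intro x y hxy
    simp only [hCL0]
    congr 1
    refine propext (exists_congr fun A => and_congr_right fun _ => and_congr_right fun hAV => ?_)
    exact forall_congr' fun e => imp_congr_right fun he => by rw [hxy e (hAV e he)]
  have hCL0cl : ∀ x, CL0 x = true → cliqueFn n k x = true := by
    intro x hx
    simp only [hCL0, decide_eq_true_eq] at hx
    obtain ⟨A, hA, -, hAx⟩ := hx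
    exact (cliqueFn_eq_true_iff_exists k x).2
      ⟨A, (mem_powersetCard.1 hA).2, fun e he => hAx e ((cliqueVec_eq_true_iff A e).2 he)⟩
  have hsplit : ∀ x, cliqueFn n k x = true → CL0 x = true ∨ ∃ A ∈ powersetCard k (univ : Finset (Fin n)),
      (∃ e ∈ V, cliqueVec A e = true) ∧ ∀ e, cliqueVec A e = true → x e = true := by
    intro x hx
    obtain ⟨A, hAk, hAx⟩ := (cliqueFn_eq_true_iff_exists k x).1 hx
    have hA : A ∈ powersetCard k (univ : Finset (Fin n)) := mem_powersetCard.2 ⟨subset_univ _, hAk⟩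
    have hAx' : ∀ e, cliqueVec A e = true → x e = true := fun e he => hAx e ((cliqueVec_eq_true_iff A e).1 he)
    by_cases htc : ∃ e ∈ V, cliqueVec A e = true
    · exact Or.inr ⟨A, hA, htc, hAx'⟩
    · left
      simp only [hCL0, decide_eq_true_eq]
      push Not at htc
      exact ⟨A, hA, fun e he heV => absurd he (by simpa using htc e heV), hAx'⟩
  -- the counts
  have hs : 0 < (#(slice n j) : ℝ) := by exact_mod_cast ts_card_slice_pos hj
  set s : ℝ := (#(slice n j) : ℝ) with hsdef
  set a : ℝ := (#((slice n j).filter fun x => f x = true) : ℝ) with hadef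
  set c0 : ℝ := (#((slice n j).filter fun x => CL0 x = true) : ℝ) with hc0def
  set fc0 : ℝ := (#((slice n j).filter fun x => f x = true ∧ CL0 x = true) : ℝ) with hfc0def
  set c1 : ℝ := (#((slice n j).filter fun x => ∃ A ∈ powersetCard k (univ : Finset (Fin n)),
    (∃ e ∈ V, cliqueVec A e = true) ∧ ∀ e, cliqueVec A e = true → x e = true) : ℝ) with hc1def
  set cl : ℝ := (#((slice n j).filter fun x => cliqueFn n k x = true) : ℝ) with hcldef
  set E : ℝ := (#((slice n j).filter fun x => f x ≠ cliqueFn n k x) : ℝ) with hEdef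
  -- (1) negative correlation of `f` and `CL₀`
  have h1 : fc0 * s ≤ a * c0 := by
    have h := fprm_slice_negCorr V hf hCL0m hfV hCL0V j
    rw [hfc0def, hsdef, hadef, hc0def, filter_slice_eq_filter_wt, filter_slice_eq_filter_wt,
      filter_slice_eq_filter_wt, card_slice_eq_card_filter_wt]
    exact h
  -- (2) `CL₀ ⊆ (f ∧ CL₀) ∪ err`
  have h2 : c0 ≤ fc0 + E := by
    have hsub : ((slice n j).filter fun x => CL0 x = true) ⊆
        ((slice n j).filter fun x => f x = true ∧ CL0 x = true) ∪ ((slice n j).filter fun x => f x ≠ cliqueFn n k x) := by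
      intro x hx
      rw [mem_filter] at hx
      rw [mem_union, mem_filter, mem_filter]
      by_cases hfx : f x = true
      · exact Or.inl ⟨hx.1, hfx, hx.2⟩
      · refine Or.inr ⟨hx.1, ?_⟩
        rw [hCL0cl x hx.2]
        exact hfx
    have := (card_le_card hsub).trans (card_union_le _ _)
    rw [hc0def, hfc0def, hEdef]
    exact_mod_cast this
  -- (3) `f ⊆ err ∪ (f ∧ CL₀) ∪ CL₁`
  have h3 : a ≤ E + fc0 + c1 := by
    have hsub : ((slice n j).filter fun x => f x = true) ⊆
        (((slice n j).filter fun x => f x ≠ cliqueFn n k x) ∪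
          ((slice n j).filter fun x => f x = true ∧ CL0 x = true)) ∪
          ((slice n j).filter fun x => ∃ A ∈ powersetCard k (univ : Finset (Fin n)),
            (∃ e ∈ V, cliqueVec A e = true) ∧ ∀ e, cliqueVec A e = true → x e = true) := by
      intro x hx
      rw [mem_filter] at hx
      simp only [mem_union, mem_filter]
      by_cases hc : cliqueFn n k x = true
      · rcases hsplit x hc with h0 | h1'
        · exact Or.inl (Or.inr ⟨hx.1, hx.2, h0⟩)
        · exact Or.inr ⟨hx.1, h1'⟩
      · refine Or.inl (Or.inl ⟨hx.1, ?_⟩)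
        rw [hx.2]
        exact fun h => hc h.symm
    have := ((card_le_card hsub).trans (card_union_le _ _)).trans
      (Nat.add_le_add_right (card_union_le _ _) _)
    rw [hadef, hEdef, hfc0def, hc1def]
    exact_mod_cast this
  -- (4) `CL₀ ⊆ CLIQUE`
  have h4 : c0 ≤ cl := by
    have hsub : ((slice n j).filter fun x => CL0 x = true) ⊆ ((slice n j).filter fun x => cliqueFn n k x = true) :=
      fun x hx => mem_filter.2 ⟨(mem_filter.1 hx).1, hCL0cl x (mem_filter.1 hx).2⟩
    rw [hc0def, hcldef]
    exact_mod_cast card_le_card hsub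
  -- (5) `CLIQUE ⊆ CL₀ ∪ CL₁`
  have h5 : cl ≤ c0 + c1 := by
    have hsub : ((slice n j).filter fun x => cliqueFn n k x = true) ⊆
        ((slice n j).filter fun x => CL0 x = true) ∪
          ((slice n j).filter fun x => ∃ A ∈ powersetCard k (univ : Finset (Fin n)),
            (∃ e ∈ V, cliqueVec A e = true) ∧ ∀ e, cliqueVec A e = true → x e = true) := by
      intro x hx
      rw [mem_filter] at hx
      rw [mem_union, mem_filter, mem_filter]
      rcases hsplit x hx.2 with h0 | h1'
      · exact Or.inl ⟨hx.1, h0⟩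
      · exact Or.inr ⟨hx.1, h1'⟩
    have := (card_le_card hsub).trans (card_union_le _ _)
    rw [hcldef, hc0def, hc1def]
    exact_mod_cast this
  -- the arithmetic, with `t = s / k!`
  have hkf : (6 : ℝ) ≤ k.factorial := by
    have : (3 : ℕ).factorial ≤ k.factorial := Nat.factorial_le hk
    exact_mod_cast this
  have hkf0 : (0 : ℝ) < k.factorial := by linarith
  set t : ℝ := s / k.factorial with htdef
  have hts : t ≤ s / 6 := div_le_div_of_nonneg_left hs.le (by norm_num) hkf
  have hlow' : 5 / 6 * t ≤ cl := by
    have : 5 / (6 * (k.factorial : ℝ)) * s = 5 / 6 * t := by rw [htdef]; field_simp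
    rw [← this]; exact hlow
  have h6 : c1 ≤ t / 12 := by
    have : 1 / (12 * (k.factorial : ℝ)) * s = t / 12 := by rw [htdef]; field_simp
    rw [← this]; exact htouch
  have hup' : cl ≤ s / 3 := by linarith
  have hgoal : 3 / (8 * (k.factorial : ℝ)) * s = 3 / 8 * t := by rw [htdef]; field_simp
  rw [hgoal]
  have ha0 : 0 ≤ a := Nat.cast_nonneg _
  have hc0 : 0 ≤ c0 := Nat.cast_nonneg _
  exact err_arith hs ha0 hc0 hts h1 h2 h3 h4 hup' h5 hlow' h6

/-! ## Small circuits on one central slice -/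

/-- **Small `{∧₂,∨₂}`-circuits err on a constant fraction of every central slice.** For `k ≥ 3`, eventually in `n`:
for every central `j` and every `{∧₂, ∨₂}`-circuit `C` with `(2·|C| + 1) · 4k(k-1)k! ≤ n(n-1)` (in particular every
`C` with `|C| ≤ n² / (25 k² k!)`), `C` disagrees with `CLIQUE_k` on at least `3/(8k!) · #slice_j` graphs of the slice `j`.
The light cone of `C` has `≤ 2|C| + 1` edges (`fprm_card_lightCone_le_of_monotoneBasis`), the `k`-cliques touching it
are rare by `fprm_card_slice_cliqueTouch_le` and the first moment `C(n,k)(j/C(n,2))^{C(k,2)} ≤ 1/3`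
(`ts_eventually_window`), the clique density of the slice is `≥ 5/(6k!)` (`stub_cliqueDensityLower`), and
`fprm_sliceErr_ge_of_junta` applies to the monotone junta `C.eval`. [folklore] -/
theorem fprm_sliceErr_ge_of_small (k : ℕ) (hk : 3 ≤ k) :
    ∀ᶠ n : ℕ in atTop, ∀ j : ℕ, Central k n j → ∀ C : Circuit (Edge n), C.IsOver monotoneBasis →
      (2 * C.size + 1) * (4 * k * (k - 1) * k.factorial) ≤ n * (n - 1) →
        3 / (8 * (k.factorial : ℝ)) * #(slice n j) ≤ #(errSet n k j C) := by
  have hk2 : 2 ≤ k := by omega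
  have hkf : (6 : ℝ) ≤ k.factorial := by
    have : (3 : ℕ).factorial ≤ k.factorial := Nat.factorial_le hk
    exact_mod_cast this
  have hkf0 : (0 : ℝ) < k.factorial := by linarith
  have hε : (0 : ℝ) < 1 / (12 * k.factorial) := by positivity
  filter_upwards [stub_cliqueDensityLower k hk _ hε, ts_eventually_window k hk 0, eventually_ge_atTop k]
    with n hdens hwin hkn j hj C hC hsmall
  obtain ⟨hN, hwj⟩ := hwin
  obtain ⟨-, hwi⟩ := hwj j hj
  obtain ⟨hjN, hmom⟩ := hwi j (Nat.le_add_right j 0)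
  have hn2 : 2 ≤ n := by omega
  have hs : 0 < (#(slice n j) : ℝ) := by exact_mod_cast ts_card_slice_pos hjN
  -- the junta
  set V : Finset (Edge n) := C.lightCone with hVdef
  have hV : #V ≤ 2 * C.size + 1 := fprm_card_lightCone_le_of_monotoneBasis C hC
  have hf : Monotone C.eval := C.monotone_eval_of_isOver_monotoneBasis hC
  have hfV : ∀ x y : Edge n → Bool, (∀ e ∈ V, x e = y e) → C.eval x = C.eval y :=
    fun x y hxy => C.eval_congr_lightCone hxy
  -- clique density from below: `5/(6k!) ≤ 1/k! - 1/(2k!²) - 1/(12k!)` as `k! ≥ 6`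
  have hlow : 5 / (6 * (k.factorial : ℝ)) * #(slice n j) ≤ #((slice n j).filter fun x => cliqueFn n k x = true) := by
    refine le_trans (mul_le_mul_of_nonneg_right ?_ hs.le) (hdens j hj)
    rw [div_le_iff₀ (by positivity)]
    have h1 : (1 / (k.factorial : ℝ)) ^ 2 / 2 * (6 * k.factorial) = 3 / k.factorial := by
      field_simp; ring
    have h2 : 1 / (k.factorial : ℝ) * (6 * k.factorial) = 6 := by field_simp
    have h3 : 1 / (12 * (k.factorial : ℝ)) * (6 * k.factorial) = 1 / 2 := by field_simp; ring
    rw [sub_mul, sub_mul, h1, h2, h3]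
    have h4 : 3 / (k.factorial : ℝ) ≤ 1 / 2 := by rw [div_le_iff₀ hkf0]; linarith
    linarith
  -- clique density from above: first moment `≤ 1/3`
  have hup : (#((slice n j).filter fun x => cliqueFn n k x = true) : ℝ) ≤ 1 / 3 * #(slice n j) := by
    have h := (ts_sliceFrac_clique_le (k := k) hjN hN).trans hmom
    rwa [div_le_iff₀ hs] at h
  -- cliques touching the light cone are rare
  have htouch : (#((slice n j).filter fun x => ∃ A ∈ powersetCard k (univ : Finset (Fin n)),
      (∃ e ∈ V, cliqueVec A e = true) ∧ ∀ e, cliqueVec A e = true → x e = true) : ℝ) ≤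
      1 / (12 * (k.factorial : ℝ)) * #(slice n j) := by
    refine (fprm_card_slice_cliqueTouch_le V hk2 hjN hN).trans ?_
    -- `4·k!·(2|C|+1)·C(n-2,k-2) ≤ C(n,k)` from the size hypothesis and `C(n,k)k(k-1) = n(n-1)C(n-2,k-2)`
    have hkk : 0 < k * (k - 1) := Nat.mul_pos (by omega) (by omega)
    have hM : 4 * k.factorial * ((2 * C.size + 1) * (n - 2).choose (k - 2)) ≤ n.choose k := by
      refine Nat.le_of_mul_le_mul_right ?_ hkk
      rw [choose_mul_eq_mul_choose_sub_two hn2 hk2]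
      calc 4 * k.factorial * ((2 * C.size + 1) * (n - 2).choose (k - 2)) * (k * (k - 1))
          = (2 * C.size + 1) * (4 * k * (k - 1) * k.factorial) * (n - 2).choose (k - 2) := by ring
        _ ≤ n * (n - 1) * (n - 2).choose (k - 2) := Nat.mul_le_mul_right _ hsmall
    have hM' : (4 * k.factorial * ((2 * C.size + 1) * (n - 2).choose (k - 2)) : ℝ) ≤ n.choose k := by
      exact_mod_cast hM
    have hθ : 0 ≤ ((j : ℝ) / n.choose 2) ^ k.choose 2 := by positivity
    have hV' : (#V : ℝ) ≤ 2 * C.size + 1 := by exact_mod_cast hV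
    -- `(2|C|+1)·C(n-2,k-2)·θ^K ≤ C(n,k)·θ^K/(4k!) ≤ 1/(12k!)`
    have h1 : (#V : ℝ) * ((n - 2).choose (k - 2) : ℝ) * (((j : ℝ) / n.choose 2) ^ k.choose 2 * #(slice n j)) ≤
        (2 * C.size + 1) * ((n - 2).choose (k - 2) : ℝ) * (((j : ℝ) / n.choose 2) ^ k.choose 2 * #(slice n j)) := by
      apply mul_le_mul_of_nonneg_right _ (by positivity)
      exact mul_le_mul_of_nonneg_right hV' (Nat.cast_nonneg _)
    refine h1.trans ?_
    have h2 : (2 * C.size + 1) * ((n - 2).choose (k - 2) : ℝ) * ((j : ℝ) / n.choose 2) ^ k.choose 2 ≤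
        1 / (12 * (k.factorial : ℝ)) := by
      rw [le_div_iff₀ (by positivity)]
      calc (2 * C.size + 1) * ((n - 2).choose (k - 2) : ℝ) * ((j : ℝ) / n.choose 2) ^ k.choose 2 * (12 * k.factorial)
          = 3 * ((4 * k.factorial * ((2 * C.size + 1) * (n - 2).choose (k - 2)) : ℝ) *
              ((j : ℝ) / n.choose 2) ^ k.choose 2) := by ring
        _ ≤ 3 * ((n.choose k : ℝ) * ((j : ℝ) / n.choose 2) ^ k.choose 2) := by
            apply mul_le_mul_of_nonneg_left _ (by norm_num)
            exact mul_le_mul_of_nonneg_right hM' hθ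
        _ ≤ 3 * (1 / 3) := by linarith
        _ = 1 := by norm_num
    calc (2 * C.size + 1) * ((n - 2).choose (k - 2) : ℝ) * (((j : ℝ) / n.choose 2) ^ k.choose 2 * #(slice n j))
        = ((2 * C.size + 1) * ((n - 2).choose (k - 2) : ℝ) * ((j : ℝ) / n.choose 2) ^ k.choose 2) * #(slice n j) := by
          ring
      _ ≤ 1 / (12 * (k.factorial : ℝ)) * #(slice n j) := mul_le_mul_of_nonneg_right h2 hs.le
  rw [errSet_eq_filter_slice]
  exact fprm_sliceErr_ge_of_junta hk V C.eval hf hfV hjN hlow hup htouch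

/-! ## The rungs `c ≤ 1` of the crux schedule -/

/-- **The crux schedule at exponent `1`, for every `k ≥ 3` and every width** (registered sub-goal `fprm_bandLB_one` of
stmt-PneNP-2834): `BandLB 1 k w (1/(4k!))` — eventually in `n`, every `{∧₂,∨₂}`-circuit whose band error around a
central `j` is at most `1/(4k!)` has more than `n` gates. (A circuit with `≤ n` gates reads `≤ 2n+1` edges and errs on
`≥ 3/(8k!) > 1/(4k!)` of the slice `j` alone.) [folklore] -/
theorem fprm_bandLB_one : ∀ k : ℕ, 3 ≤ k → ∀ w : ℕ, BandLB 1 k w (1 / (4 * (k.factorial : ℝ))) := by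
  intro k hk w
  suffices h0 : BandLB 1 k 0 (1 / (4 * (k.factorial : ℝ))) from h0.mono_width (Nat.zero_le w)
  have hkf0 : (0 : ℝ) < k.factorial := by exact_mod_cast Nat.factorial_pos k
  filter_upwards [fprm_sliceErr_ge_of_small k hk, ts_eventually_window k hk 0,
    eventually_ge_atTop (12 * k * (k - 1) * k.factorial + 1)] with n hsmall hwin hn j hj C hC herr
  obtain ⟨hN, hwj⟩ := hwin
  obtain ⟨-, hwi⟩ := hwj j hj
  obtain ⟨hjN, -⟩ := hwi j (Nat.le_add_right j 0)
  by_contra hsize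
  rw [not_lt, pow_one] at hsize
  -- `(2|C|+1)·4k(k-1)k! ≤ (2n+1)·4k(k-1)k! ≤ 3n·4k(k-1)k! ≤ n(n-1)`
  have hsm : (2 * C.size + 1) * (4 * k * (k - 1) * k.factorial) ≤ n * (n - 1) := by
    calc (2 * C.size + 1) * (4 * k * (k - 1) * k.factorial) ≤ (3 * n) * (4 * k * (k - 1) * k.factorial) :=
          Nat.mul_le_mul_right _ (by omega)
      _ = n * (12 * k * (k - 1) * k.factorial) := by ring
      _ ≤ n * (n - 1) := Nat.mul_le_mul_left _ (by omega)
  have herr' := hsmall j hj C hC hsm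
  have hs : 0 < (#(slice n j) : ℝ) := by exact_mod_cast ts_card_slice_pos hjN
  -- the band of width `0` is the single slice `j`
  have hband : bandErr n k j 0 C = (#(errSet n k j C) : ℝ) / #(slice n j) := by
    simp [bandErr]
  rw [hband, div_le_iff₀ hs] at herr
  have : 3 / (8 * (k.factorial : ℝ)) * #(slice n j) ≤ 1 / (4 * (k.factorial : ℝ)) * #(slice n j) :=
    herr'.trans herr
  have h := le_of_mul_le_mul_right this hs
  rw [div_le_div_iff₀ (by positivity) (by positivity)] at h
  nlinarith

/-- **The unconditional rungs `c ≤ 1` of the crux schedule**: for every `c ≤ 1` there are `k ≥ 3`, `w` and `δ > 0`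
with `BandLB c k w δ` (in fact every `k ≥ 3`, every `w`, `δ = 1/(4k!)`). The crux `ConstantBand` is this statement
for EVERY `c` (`constantBand_iff`); the first open rung is `c = 2`. [folklore] -/
theorem fprm_constantBandSchedule_le_one :
    ∀ c : ℕ, c ≤ 1 → ∃ k : ℕ, 3 ≤ k ∧ ∃ w : ℕ, ∃ δ : ℝ, 0 < δ ∧ BandLB c k w δ :=
  fun _ hc => ⟨3, le_rfl, 0, 1 / (4 * ((3 : ℕ).factorial : ℝ)), by positivity,
    (fprm_bandLB_one 3 le_rfl 0).anti_exp hc⟩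

/-- **The same rung for crux #2** (`SingleThreshold`, stmt-PneNP-2833, schedule form `LowerBoundAt c k δ` of its
`Negative/LoadBearing.lean`): for every `k ≥ 3`, eventually in `n`, every `{∧₂,∨₂}`-circuit that errs with probability
`≤ 1/(8k!)` against `CLIQUE_k` on `G(n, n^{-2/(k-1)})` has more than `n` gates — `fprm_bandLB_one` at `w = 0` through the
exponent-wise transfer `lowerBoundAt_of_bandLB` (stmt-PneNP-2839). [folklore] -/
theorem fprm_lowerBoundAt_one (k : ℕ) (hk : 3 ≤ k) :
    Summit.PneNP.PneNP.Theorems.SingleThreshold.Negative.LowerBoundAt 1 k (1 / (8 * (k.factorial : ℝ))) := by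
  have h := Summit.PneNP.PneNP.Theorems.lowerBoundAt_of_bandLB hk (fprm_bandLB_one k hk 0)
  have he : (1 / (4 * (k.factorial : ℝ)) / (2 ^ (0 + 1) * (2 * ((0 : ℕ) : ℝ) + 1)) : ℝ) = 1 / (8 * k.factorial) := by
    push_cast; ring
  rwa [he] at h

end Summit.PneNP.PneNP.Cruxes.ConstantBand.FlatPriorRelativeMinterms

end
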